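import Summits.Ventures.PercRepro.RankLevelSetLevelSevenT13Cell74
import Summits.Ventures.PercRepro.RankLevelSetLevelSevenT13Dev1
import Summits.Ventures.PercRepro.RankLevelSetLevelSevenT13Dev2
import Summits.Ventures.PercRepro.RankLevelSetLevelSevenT13Dev3
import Summits.Ventures.PercRepro.RankLevelSetLevelSevenT13Dev4
import Summits.Ventures.PercRepro.S4MidKeyThirteen
import Summits.Ventures.PercRepro.S4SevenWindow
import Summits.Ventures.PercRepro.RankLevelSetLevelSixRowsNineToFifteen

/-!
# PercRepro — THE 13 ROW OF LEVEL `7`: `c025_core_seven_thirteen (d ≥ 8) : RLS M 13 7` ON EVERY `e`-FREE CORE OF RANK `13`, AND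
**THEOREM C₇ AT RANK `13`** (p7 g24, S4 feeder; p8's assembly shape — NO window claim, p9 owns S4)

The core cells `(13, d)`: `8 ≤ d ≤ 74` by the coloop device with the lossy ladder (`c025_core_seven_thirteen_<d>`: `k` coloops reduce to the natural cell
`(13 − k, d)` of the row `13 − k` at the same corank, the rest retired — the device cells `RankLevelSetLevelSevenT13Cell<d>` for `d ∈ {74 … 74}` and the generic device `c025_core_seven_of_cells` in RankLevelSetLevelSevenT13Dev1, RankLevelSetLevelSevenT13Dev2, RankLevelSetLevelSevenT13Dev3, RankLevelSetLevelSevenT13Dev4),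
`d ≥ 75` by p1's middle key (`S4Mid.c025_core_seven_midkey_thirteen`, no coloop-freeness needed). Then the level-6 glue `rls_seven_at_of_core 13` on `c025_six_all`
(level `6` at `p = 12`) gives level `7` at `p = 13`: **`c025_seven_at_thirteen : RLS M 13 7`** for every finite matroid.
Axioms: standard.
-/

open scoped Matroid

namespace PercRepro

namespace ThmN

variable {α : Type}

/-- **The core cell `(13, d)` at every corank `d ≥ 8`, every `e`-free core.** -/
theorem c025_core_seven_thirteen (M : Matroid α) [M.Finite] (d : ℕ) (hd8 : 8 ≤ d)
    (hR : M.eRank = (13 : ℕ∞)) (hn : M.E.ncard = 13 + d)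
    (hfree : ∀ e ∈ M.E, ∃ A ⊆ M.E \ {e}, e ∉ M.closure A ∧ e ∉ M.closure ((M.E \ {e}) \ A)) :
    RLS M 13 7 := by
  rcases Nat.lt_or_ge d 75 with hlt | hge
  · interval_cases d
    · exact c025_core_seven_thirteen_8 M hR hn hfree
    · exact c025_core_seven_thirteen_9 M hR hn hfree
    · exact c025_core_seven_thirteen_10 M hR hn hfree
    · exact c025_core_seven_thirteen_11 M hR hn hfree
    · exact c025_core_seven_thirteen_12 M hR hn hfree
    · exact c025_core_seven_thirteen_13 M hR hn hfree
    · exact c025_core_seven_thirteen_14 M hR hn hfree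
    · exact c025_core_seven_thirteen_15 M hR hn hfree
    · exact c025_core_seven_thirteen_16 M hR hn hfree
    · exact c025_core_seven_thirteen_17 M hR hn hfree
    · exact c025_core_seven_thirteen_18 M hR hn hfree
    · exact c025_core_seven_thirteen_19 M hR hn hfree
    · exact c025_core_seven_thirteen_20 M hR hn hfree
    · exact c025_core_seven_thirteen_21 M hR hn hfree
    · exact c025_core_seven_thirteen_22 M hR hn hfree
    · exact c025_core_seven_thirteen_23 M hR hn hfree
    · exact c025_core_seven_thirteen_24 M hR hn hfree
    · exact c025_core_seven_thirteen_25 M hR hn hfree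
    · exact c025_core_seven_thirteen_26 M hR hn hfree
    · exact c025_core_seven_thirteen_27 M hR hn hfree
    · exact c025_core_seven_thirteen_28 M hR hn hfree
    · exact c025_core_seven_thirteen_29 M hR hn hfree
    · exact c025_core_seven_thirteen_30 M hR hn hfree
    · exact c025_core_seven_thirteen_31 M hR hn hfree
    · exact c025_core_seven_thirteen_32 M hR hn hfree
    · exact c025_core_seven_thirteen_33 M hR hn hfree
    · exact c025_core_seven_thirteen_34 M hR hn hfree
    · exact c025_core_seven_thirteen_35 M hR hn hfree
    · exact c025_core_seven_thirteen_36 M hR hn hfree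
    · exact c025_core_seven_thirteen_37 M hR hn hfree
    · exact c025_core_seven_thirteen_38 M hR hn hfree
    · exact c025_core_seven_thirteen_39 M hR hn hfree
    · exact c025_core_seven_thirteen_40 M hR hn hfree
    · exact c025_core_seven_thirteen_41 M hR hn hfree
    · exact c025_core_seven_thirteen_42 M hR hn hfree
    · exact c025_core_seven_thirteen_43 M hR hn hfree
    · exact c025_core_seven_thirteen_44 M hR hn hfree
    · exact c025_core_seven_thirteen_45 M hR hn hfree
    · exact c025_core_seven_thirteen_46 M hR hn hfree
    · exact c025_core_seven_thirteen_47 M hR hn hfree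
    · exact c025_core_seven_thirteen_48 M hR hn hfree
    · exact c025_core_seven_thirteen_49 M hR hn hfree
    · exact c025_core_seven_thirteen_50 M hR hn hfree
    · exact c025_core_seven_thirteen_51 M hR hn hfree
    · exact c025_core_seven_thirteen_52 M hR hn hfree
    · exact c025_core_seven_thirteen_53 M hR hn hfree
    · exact c025_core_seven_thirteen_54 M hR hn hfree
    · exact c025_core_seven_thirteen_55 M hR hn hfree
    · exact c025_core_seven_thirteen_56 M hR hn hfree
    · exact c025_core_seven_thirteen_57 M hR hn hfree
    · exact c025_core_seven_thirteen_58 M hR hn hfree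
    · exact c025_core_seven_thirteen_59 M hR hn hfree
    · exact c025_core_seven_thirteen_60 M hR hn hfree
    · exact c025_core_seven_thirteen_61 M hR hn hfree
    · exact c025_core_seven_thirteen_62 M hR hn hfree
    · exact c025_core_seven_thirteen_63 M hR hn hfree
    · exact c025_core_seven_thirteen_64 M hR hn hfree
    · exact c025_core_seven_thirteen_65 M hR hn hfree
    · exact c025_core_seven_thirteen_66 M hR hn hfree
    · exact c025_core_seven_thirteen_67 M hR hn hfree
    · exact c025_core_seven_thirteen_68 M hR hn hfree
    · exact c025_core_seven_thirteen_69 M hR hn hfree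
    · exact c025_core_seven_thirteen_70 M hR hn hfree
    · exact c025_core_seven_thirteen_71 M hR hn hfree
    · exact c025_core_seven_thirteen_72 M hR hn hfree
    · exact c025_core_seven_thirteen_73 M hR hn hfree
    · exact c025_core_seven_thirteen_74 M hR hn hfree
  · exact S4Mid.c025_core_seven_midkey_thirteen M (by omega) hfree

/-- **THEOREM C₇ AT RANK `13`**: level `7` at `p = 13` for every finite matroid (on level `6` at `p = 12`, `c025_six_all`). -/
theorem c025_seven_at_thirteen (M : Matroid α) [M.Finite] : RLS M 13 7 :=
  rls_seven_at_of_core 13 (by norm_num) (fun M _ => c025_six_all M 12 (by norm_num))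
    (fun M _ d hd hR hn hfree => c025_core_seven_thirteen M d hd hR hn hfree) M

end ThmN

end PercRepro
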